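import Summits.HodgeConjecture.HodgeConjecture.Theorems.F0P3SpectralPacketSphericalRigidity   -- ★ LH7-p03 p848041: `GlobalPacket.comap_symm_mem_of_evpAtψ_eq` (Satake at the slot) (+ ★ p847962 `LocalPacketKit.eq_of_meet`∕`mem_aTok_of_mem`, ★ 3v, ★ 3w)
import Summits.HodgeConjecture.HodgeConjecture.Theorems.F0P3SpectralPacketXiGermSums          -- ★ (N) FILE 3t: (L3) `SpectralPacketH.XiRigidityH` (+ ★ 3r `XiHPacketsSigned`, `rhoXiS`, `mem_xiH_rhoXiS_iff`; ★ 3h `evpHψ`; ★ 3g `imageG`, `ramFinsetH`)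
import Summits.HodgeConjecture.HodgeConjecture.Theorems.F0P3GlobalPacketNValues              -- ★ LH7-p03 p847904: `GlobalPacketH.eq_of_loc_eq`
import HarnessLib

/-!
# (PK-A-H) RIGIDITY REDUCED — (L3) `XiRigidityH` FROM (KD3), the `ξ_H`-FIBRE of the A-token, SATAKE AT THE GOOD PLACES (in-house), and ONE global `H`-side input
# (strong multiplicity one at the finitely many bad places) — kit-generic; the `H`-twin of ★ `F0P3SpectralPacketRigidityReduction` ∕ ★ `F0P3SpectralPacketSphericalRigidity`

Cell `hodgecm-mathlib`, F0∕P3c line LH7 (closer stub `stub_PKtuple : PKtupleLetter`, `Cruxes/H413/Lines/F0_U3LettersRung1.lean` ED. 38 «PK-ε», row #181),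
crux H413 = `stmt-HodgeConjecture-24833`; organ payer LH7-p03 (g0), DEFAULT organ «RIGID-H-RED» (censuses `F0/P3c/LH7/LH7-p02/g0/CENSUS-PKtuple-inhouse.v1.md` ec8ac256ebd4be69
§3 row (PK-A-H) «satisfiable by choosing `DiscH` … plus ★ `F0P3XiRigid`»; `F0/P3c/LH7/LH7-p01/g0/CENSUS-PKtuple-print.v1.1.md` f3ec0ab23d6c1399 rows A-H ∕ 21 (KD3)).
`--supports stmt-HodgeConjecture-24833`; closes no stub.  Touches neither `𝔩.pair` nor the `ε` slot (LEAD T12-11 (5) cut rule).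

THE MATHEMATICS [Rogawski1990 §13.3 Thm. 13.3.5 p. 202, p. 202 «`Π_a(G)` and `Π_e(G)` are disjoint», p. 203; §13.7 p. 206; §14.6 (14.6.3) p. 243 «there exists a unique `ξ` …»].
(L3) `XiRigidityH hH ψ νG tXi` (★ 3t): a discrete `H`-packet `ρ` whose IMAGE e.v.p. `evpH ρ = t(ξ_H(ρ))` (★ 3h `evpHψ := ρ.imageG.evpAtψ`) agrees with `t(ξ)` off a finite `S ⊇ ramH ρ` IS
`ξ = rhoXiS hH ξ`.  Layers, as on the `G`-side:
1. BOOKKEEPING (§1): a spectral `H`-packet is its finite tokens once (KD3) «`DiscH` pins `inf`» holds (`isDiscrete : DiscH fin inf` on both sides) — ★ `GlobalPacketH.eq_of_loc_eq` + (KD3).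
2. GOOD PLACES, IN-HOUSE (§2): at `v ∉ S ∪ S₀ ∪ ram ξ` the image token `ξ_H(ρ_v)` is unramified and its e.v.p. is `t_{πⁿ(ξ_v)}`, so by Satake injectivity (★ `comap_symm_mem_of_evpAtψ_eq`,
   [CartierCorvallis1979 §IV.1 Cor. 4.1]) `πⁿ(ξ_v) ∘ ψ_v⁻¹ ∈ ξ_H(ρ_v)`; the kit fact «the only `H_v`-packet whose image contains `πⁿ(ξ_v)` is the character packet `{ξ_v} = (rhoXiS hH ξ)_v`»
   (hypothesis `hfibH` — print: `πⁿ(ξ_v)` lies only in the A-packet `Π(ξ_v) = ξ_H(ξ_v)`, p. 199 ¶2, Prop. 13.1.3 (d); for a kit it is (KM2)+(KM3)+(KM1)+(KJ-G) plus injectivity of `ξ_H` on the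
   fibre of the A-token, §2 `fibreH_of_marker_laws`) then gives `ρ_v = (rhoXiS hH ξ)_v` THERE.
3. BAD PLACES (hypothesis `hglobH`, print): a `DiscH`-discrete `ρ` agreeing with `ξ` off the finite set `S ∪ S₀ ∪ ram ξ` agrees everywhere — strong multiplicity one on `H = U(2) × U(1)`
   for the discrete packets against a character [§13.3 Thm. 13.3.5 for `H`; for the intended `DiscH` («`ρ` is some `ρ(ξ′)`») it is rigidity of automorphic characters, ★ `F0P3XiRigid` ∕
   ★ `OneDimAutRepH.ext_of_exists_bc_localComponent_eq_of_split`].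
Given 2–3 and (KD3), (L3) follows (§3 `xiRigidityH_of_fibre`); §3 `xiRigidityH_of_marker_laws` trades `hfibH` for the marker rows + `ξ_H`-injectivity on the A-fibre (`hinj`, the SAME
placewise fibre fact that gives `n(Π(ξ)) = ½` in ★ p847904 `piXiHm_n_eq_half_of_forall_xiH_eq`).

CONTENTS:
* §1 `SpectralPacketH.eq_of_fin_eq_of_inf_eq`, `SpectralPacketH.eq_of_loc_eq_of_discH_pins` ((KD3) bookkeeping).
* §2 `SpectralPacketH.transport_πn_mem_xiH_of_evpHψ_eq` (one place), `SpectralPacketH.transport_πn_mem_xiH_of_eqOff` (every `v ∉ S ∪ S₀ ∪ ram ξ`), `SpectralPacketH.fibreH_of_marker_laws`.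
* §3 **`SpectralPacketH.xiRigidityH_of_fibre`**, **`SpectralPacketH.xiRigidityH_of_marker_laws`**.
No instance, no notation, no named fact, no `sorry`.
HONEST LABEL: HC_CM is proved only modulo the 7 printed citations (2 remaining: hLiu418 = stmt-HodgeConjecture-24832, h413 = stmt-HodgeConjecture-24833) until rung 0 closes;
this file proves no printed statement — it reduces the rigidity conjunct of (PK-A-H) to kit laws, Satake at the good places (in-house) and ONE named `H`-side global input.

References: [Rogawski1990] §13.3 Thm. 13.3.5 p. 202, p. 202 l. 16, p. 203, Thm. 13.3.4 p. 202; §13.1 Prop. 13.1.3 (d) p. 199, p. 199 ¶2; §13.7 p. 206; §12.1 p. 171; §14.6 (14.6.3) p. 243.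
[CartierCorvallis1979] §IV.1 Cor. 4.1.
-/

set_option autoImplicit false
-- the mandated namespace repeats `HodgeConjecture.HodgeConjecture`, as in every `Theorems/*.lean` of this sub-problem
set_option linter.dupNamespace false

noncomputable section

open NumberField IsDedekindDomain MeasureTheory
open scoped Matrix MatrixGroups

open Literature.NumberTheory Literature.NumberTheory.Automorphic Literature.NumberTheory.Automorphic.UnitaryGroup
open Literature.NumberTheory.Rogawski1990 Literature.NumberTheory.GaloisRepresentations
open Literature.RepresentationTheory.BorelWallach2000 Literature.RepresentationTheory.KonnoKonno2007
open Summit.HodgeConjecture.HodgeConjecture.Cruxes.H413.F0P3InnerFormClassificationV6 (splitForm EvpData EqOff)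
open Summit.HodgeConjecture.HodgeConjecture.Cruxes.H413.F0P3LocalPacketKit
open Summit.HodgeConjecture.HodgeConjecture.Cruxes.H413.F0P3ArchPacketKit

namespace Summit.HodgeConjecture.HodgeConjecture.Cruxes.H413.F0P3SpectralPacket.SpectralPacketH

open Summit.HodgeConjecture.HodgeConjecture.Cruxes.H413.F0P3GlobalPacket

/-! ## §1 Bookkeeping: a spectral `H`-packet is its finite tokens under (KD3) [§13.3 p. 202; Thm. 13.3.5 for `H`] -/

section Ext

variable {L : Type} [Field L] [NumberField L] [IsCMField L] {H' : Matrix (Fin 3) (Fin 3) L}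
  {𝔩 : ∀ v : HeightOneSpectrum (𝓞 ↥(maximalRealSubfield L)), LocalPacketKit L H' v} {𝔞 : ArchPacketKit} {𝔞H : ArchPacketKitH 𝔞}
  {DiscH : GlobalPacketH 𝔩 → 𝔞H.PktInfH → Prop}

/-- **Extensionality of `SpectralPacketH`**: a discrete `H`-packet is its finite family and its archimedean packet (the other two fields are propositions). [cite: Rogawski1990, §13.3 p. 202] -/
theorem eq_of_fin_eq_of_inf_eq {ρ ρ' : SpectralPacketH 𝔩 𝔞 𝔞H DiscH} (hf : ρ.fin = ρ'.fin) (hi : ρ.inf = ρ'.inf) : ρ = ρ' := by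
  cases ρ with
  | mk fin inf hc hd =>
    cases ρ' with
    | mk fin' inf' hc' hd' =>
      simp only at hf hi
      subst hf
      subst hi
      rfl

/-- **Under (KD3) «`DiscH` pins `inf`», a spectral `H`-packet is its finite tokens**: `ρ_v = ρ′_v` for all `v` ⇒ `ρ = ρ′` (both are `DiscH`-discrete at their own `inf`).
[cite: Rogawski1990, §13.3 p. 202, Thm. 13.3.5 p. 202] -/
theorem eq_of_loc_eq_of_discH_pins (hKD3 : ∀ (σ : GlobalPacketH 𝔩) (P P' : 𝔞H.PktInfH), DiscH σ P → DiscH σ P' → P = P')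
    {ρ ρ' : SpectralPacketH 𝔩 𝔞 𝔞H DiscH} (h : ∀ v, ρ.fin.loc v = ρ'.fin.loc v) : ρ = ρ' := by
  have hf : ρ.fin = ρ'.fin := GlobalPacketH.eq_of_loc_eq h
  refine eq_of_fin_eq_of_inf_eq hf (hKD3 ρ'.fin _ _ ?_ ρ'.isDiscrete)
  rw [← hf]
  exact ρ.isDiscrete

end Ext

/-! ## §2 Good places, in-house: Satake puts `πⁿ(ξ_v) ∘ ψ_v⁻¹` in `ξ_H(ρ_v)`; the A-fibre gives `ρ_v = ξ_v` [§13.7 p. 206; p. 199 ¶2; Prop. 13.1.3 (d)] -/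

section Good

variable {L : Type} [Field L] [NumberField L] [IsCMField L] {H : Matrix (Fin 3) (Fin 3) L}
  {𝔩 : ∀ v : HeightOneSpectrum (𝓞 ↥(maximalRealSubfield L)), LocalPacketKit L (splitForm L 3) v} {𝔞 : ArchPacketKit} {𝔞H : ArchPacketKitH 𝔞}
  {DiscH : GlobalPacketH 𝔩 → 𝔞H.PktInfH → Prop}
  [∀ v : HeightOneSpectrum (𝓞 ↥(maximalRealSubfield L)), MeasurableSpace ((cmDatum L 3 (splitForm L 3)).Local v)]
  [∀ v : HeightOneSpectrum (𝓞 ↥(maximalRealSubfield L)), BorelSpace ((cmDatum L 3 (splitForm L 3)).Local v)]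
  [∀ v : HeightOneSpectrum (𝓞 ↥(maximalRealSubfield L)), MeasurableSpace ((cmDatum L 3 H).Local v)]
  [∀ v : HeightOneSpectrum (𝓞 ↥(maximalRealSubfield L)), BorelSpace ((cmDatum L 3 H).Local v)]
  {νG' : ∀ v : HeightOneSpectrum (𝓞 ↥(maximalRealSubfield L)), Measure ((cmDatum L 3 H).Local v)}
  [∀ v, (νG' v).IsMulLeftInvariant] [∀ v, IsFiniteMeasureOnCompacts (νG' v)]
  {ψ : ∀ v : HeightOneSpectrum (𝓞 ↥(maximalRealSubfield L)), (cmDatum L 3 H).Local v ≃ₜ* (cmDatum L 3 (splitForm L 3)).Local v}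

/-- **ONE PLACE, at the slot `evpHψ`**: if `ξ_H(ρ_v)` is unramified with admissible members ((KG3′)), `ψ_v(K′_v) = K_v`, `vol(K′_v) ≠ 0`, and `ρ.evpHψ ψ (ψ_*ν′) v = t_{π′}` for an admissible
`K′_v`-spherical `π′`, then `π′ ∘ ψ_v⁻¹ ∈ ξ_H(ρ_v)`. [cite: CartierCorvallis1979, §IV.1 Cor. 4.1] [cite: Rogawski1990, §13.7 p. 206; §13.3 Thm. 13.3.4 p. 202] -/
theorem comap_symm_mem_xiH_of_evpHψ_eq (ρ : SpectralPacketH 𝔩 𝔞 𝔞H DiscH) {v : HeightOneSpectrum (𝓞 ↥(maximalRealSubfield L))} (h4 : (𝔩 v).UnramLaw)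
    (hadmQ : ∀ π ∈ (𝔩 v).mem ((𝔩 v).xiH (ρ.fin.loc v)), π.IsAdmissible)
    (hψK : (cmLocalIntegralLevel L 3 H v).map (ψ v : (cmDatum L 3 H).Local v →* (cmDatum L 3 (splitForm L 3)).Local v) = cmLocalIntegralLevel L 3 (splitForm L 3) v)
    (hvol : (νG' v).real (cmLocalIntegralLevel L 3 H v : Set ((cmDatum L 3 H).Local v)) ≠ 0)
    (hunr : (𝔩 v).unr ((𝔩 v).xiH (ρ.fin.loc v)))
    {π' : IrrClass ((cmDatum L 3 H).Local v)} (hadm : π'.IsAdmissible) (hsph : π'.IsSpherical (cmLocalIntegralLevel L 3 H v))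
    (heq : ρ.evpHψ ψ (fun w => (νG' w).map (ψ w)) v = π'.eigencharacter (cmLocalIntegralLevel L 3 H v) (νG' v)) :
    IrrClass.comap (ψ v).symm π' ∈ (𝔩 v).mem ((𝔩 v).xiH (ρ.fin.loc v)) :=
  ρ.imageG.comap_symm_mem_of_evpAtψ_eq ψ νG' h4 hψK hvol hunr (hadmQ _ (h4 _ hunr).1) hadm hsph heq

variable {Pk' : OneDimAutRepH L → ∀ v : HeightOneSpectrum (𝓞 ↥(maximalRealSubfield L)), CMLocalAPacket L H v}
  {ram : OneDimAutRepH L → Finset (HeightOneSpectrum (𝓞 ↥(maximalRealSubfield L)))}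

/-- **EVERY GOOD PLACE on the `H`-side**: from `t(ξ_H(ρ)) = t(ξ)` off `S ⊇ ramH ρ` and the record∕kit facts, `(transportAPackets ψ Pk′ ξ v).πn ∈ ξ_H(ρ_v)` for every `v ∉ S ∪ S₀ ∪ ram ξ`.
[cite: Rogawski1990, §13.7 p. 206; §13.3 Thm. 13.3.4, Thm. 13.3.5 p. 202; §12.2 p. 174 l. 1] [cite: CartierCorvallis1979, §IV.1 Cor. 4.1] -/
theorem transport_πn_mem_xiH_of_eqOff (h4 : ∀ v : HeightOneSpectrum (𝓞 ↥(maximalRealSubfield L)), (𝔩 v).UnramLaw)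
    (hKG3 : ∀ (v : HeightOneSpectrum (𝓞 ↥(maximalRealSubfield L))) (P : (𝔩 v).Pkt), ∀ π ∈ (𝔩 v).mem P, π.IsAdmissible)
    (S₀ : Finset (HeightOneSpectrum (𝓞 ↥(maximalRealSubfield L))))
    (hψK : ∀ v ∉ S₀, (cmLocalIntegralLevel L 3 H v).map (ψ v : (cmDatum L 3 H).Local v →* (cmDatum L 3 (splitForm L 3)).Local v) =
      cmLocalIntegralLevel L 3 (splitForm L 3) v)
    (hvol : ∀ v : HeightOneSpectrum (𝓞 ↥(maximalRealSubfield L)), (νG' v).real (cmLocalIntegralLevel L 3 H v : Set ((cmDatum L 3 H).Local v)) ≠ 0)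
    (hsph : ∀ (ξ : OneDimAutRepH L), ∀ v ∉ ram ξ, (Pk' ξ v).πn.IsSpherical (cmLocalIntegralLevel L 3 H v))
    (hadmn : ∀ (ξ : OneDimAutRepH L) (v : HeightOneSpectrum (𝓞 ↥(maximalRealSubfield L))), (Pk' ξ v).πn.IsAdmissible)
    {t : OneDimAutRepH L → EvpData L H}
    (ht : ∀ (ξ : OneDimAutRepH L), ∀ v ∉ ram ξ, t ξ v = (Pk' ξ v).πn.eigencharacter (cmLocalIntegralLevel L 3 H v) (νG' v))
    (ξ : OneDimAutRepH L) {S : Finset (HeightOneSpectrum (𝓞 ↥(maximalRealSubfield L)))} {ρ : SpectralPacketH 𝔩 𝔞 𝔞H DiscH}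
    (hevp : EqOff L H S (ρ.evpHψ ψ (fun w => (νG' w).map (ψ w))) (t ξ)) (hram : ρ.ramFinsetH ⊆ S)
    {v : HeightOneSpectrum (𝓞 ↥(maximalRealSubfield L))} (hvS : v ∉ S) (hv₀ : v ∉ S₀) (hvr : v ∉ ram ξ) :
    (transportAPackets ψ Pk' ξ v).πn ∈ (𝔩 v).mem ((𝔩 v).xiH (ρ.fin.loc v)) := by
  rw [transportAPackets_πn]
  exact ρ.comap_symm_mem_xiH_of_evpHψ_eq (h4 v) (hKG3 v _) (hψK v hv₀) (hvol v) (ρ.unr_xiH_of_not_mem_ramFinsetH fun h => hvS (hram h)) (hadmn ξ v)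
    (hsph ξ v hvr) ((hevp v hvS).trans (ht ξ v hvr))

variable {aTok : ∀ v : HeightOneSpectrum (𝓞 ↥(maximalRealSubfield L)), Set (𝔩 v).Pkt}
  {PkInf : OneDimAutRepH L → LocalAPacket (GKIrrClass (uFormGroup (Fin 2) (Fin 1)))}
  {χ : OneDimAutRepH L → ∀ v : HeightOneSpectrum (𝓞 ↥(maximalRealSubfield L)),
    (UnitaryGroup.cmDatum L 2 (Matrix.of fun i j : Fin 2 => if i.val + j.val + 1 = 2 then (1 : L) else 0)).Local v ×
      (UnitaryGroup.cmDatum L 1 (Matrix.of fun i j : Fin 1 => if i.val + j.val + 1 = 1 then (1 : L) else 0)).Local v →* ℂˣ}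
  {hχ : ∀ (ξ : OneDimAutRepH L) (v : HeightOneSpectrum (𝓞 ↥(maximalRealSubfield L))),
    IsOpen (((χ ξ v).ker : Subgroup ((UnitaryGroup.cmDatum L 2 (Matrix.of fun i j : Fin 2 => if i.val + j.val + 1 = 2 then (1 : L) else 0)).Local v ×
      (UnitaryGroup.cmDatum L 1 (Matrix.of fun i j : Fin 1 => if i.val + j.val + 1 = 1 then (1 : L) else 0)).Local v)) :
      Set ((UnitaryGroup.cmDatum L 2 (Matrix.of fun i j : Fin 2 => if i.val + j.val + 1 = 2 then (1 : L) else 0)).Local v ×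
        (UnitaryGroup.cmDatum L 1 (Matrix.of fun i j : Fin 1 => if i.val + j.val + 1 = 1 then (1 : L) else 0)).Local v))}
  {ε : OneDimAutRepH L → HeightOneSpectrum (𝓞 ↥(maximalRealSubfield L)) → ℤ} {κH : OneDimAutRepH L → ℤ}

omit [∀ v : HeightOneSpectrum (𝓞 ↥(maximalRealSubfield L)), MeasurableSpace ((cmDatum L 3 (splitForm L 3)).Local v)]
  [∀ v : HeightOneSpectrum (𝓞 ↥(maximalRealSubfield L)), BorelSpace ((cmDatum L 3 (splitForm L 3)).Local v)]
  [∀ v : HeightOneSpectrum (𝓞 ↥(maximalRealSubfield L)), MeasurableSpace ((cmDatum L 3 H).Local v)]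
  [∀ v : HeightOneSpectrum (𝓞 ↥(maximalRealSubfield L)), BorelSpace ((cmDatum L 3 H).Local v)] in
/-- **THE A-FIBRE FROM THE MARKER LAWS**: under (KM1)+(KJ-G)+(KM2)+(KM3) and injectivity of `ξ_H` on the fibre of the A-token `ξ_H(ξ_v)` (`hinj`, the placewise fibre fact of ★ p847904), an
`H_v`-packet `r` whose image contains `πⁿ(ξ_v)` IS `(rhoXiS hH ξ)_v`: `ξ_H(r)` and `ξ_H(ξ_v)` are A-tokens ((KM2) read contrapositively) meeting `Π(ξ_v)`, hence equal (★ `eq_of_meet`), hence `r = ξ_v`.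
[cite: Rogawski1990, §13.1 p. 199 ¶2, Prop. 13.1.3 (d) p. 199; §13.2 p. 200 l. 1–3; §13.3 Thm. 13.3.4 p. 202] -/
theorem fibreH_of_marker_laws (hH : XiHPacketsSigned 𝔩 𝔞 𝔞H DiscH (transportAPackets ψ Pk') PkInf χ hχ ε κH)
    (hKM1 : ∀ (v : HeightOneSpectrum (𝓞 ↥(maximalRealSubfield L))) (P P' : (𝔩 v).Pkt), (𝔩 v).mem P = (𝔩 v).mem P' → (∀ c, (𝔩 v).one P c = (𝔩 v).one P' c) →
      (P ∈ aTok v ↔ P' ∈ aTok v) → P = P')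
    (hKJ : ∀ (v : HeightOneSpectrum (𝓞 ↥(maximalRealSubfield L))) (P : (𝔩 v).Pkt) (c : IrrClass ((UnitaryGroup.cmDatum L 3 (splitForm L 3)).Local v)),
      c ∉ (𝔩 v).mem P → (𝔩 v).one P c = 0)
    (hKM2 : ∀ (ξ : OneDimAutRepH L) (v : HeightOneSpectrum (𝓞 ↥(maximalRealSubfield L))) (P : (𝔩 v).Pkt), P ∉ aTok v →
      (transportAPackets ψ Pk' ξ v).πn ∉ (𝔩 v).mem P)
    (hKM3 : ∀ (ξ : OneDimAutRepH L) (v : HeightOneSpectrum (𝓞 ↥(maximalRealSubfield L))) (P : (𝔩 v).Pkt), P ∈ aTok v →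
      ((transportAPackets ψ Pk' ξ v).πn ∈ (𝔩 v).mem P ∨ ∃ c, (transportAPackets ψ Pk' ξ v).πs = some c ∧ c ∈ (𝔩 v).mem P) →
      (∀ c, c ∈ (𝔩 v).mem P ↔ (c = (transportAPackets ψ Pk' ξ v).πn ∨ (transportAPackets ψ Pk' ξ v).πs = some c)) ∧
        (𝔩 v).one P (transportAPackets ψ Pk' ξ v).πn = 1 ∧ ∀ c ∈ (𝔩 v).mem P, c ≠ (transportAPackets ψ Pk' ξ v).πn → (𝔩 v).one P c = -1)
    (hinj : ∀ (ξ : OneDimAutRepH L) (v : HeightOneSpectrum (𝓞 ↥(maximalRealSubfield L))) (r : (𝔩 v).PktH),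
      (𝔩 v).xiH r = (𝔩 v).xiH ((rhoXiS hH ξ).fin.loc v) → r = (rhoXiS hH ξ).fin.loc v)
    (ξ : OneDimAutRepH L) (v : HeightOneSpectrum (𝓞 ↥(maximalRealSubfield L))) (r : (𝔩 v).PktH)
    (hmem : (transportAPackets ψ Pk' ξ v).πn ∈ (𝔩 v).mem ((𝔩 v).xiH r)) : r = (rhoXiS hH ξ).fin.loc v := by
  have hmem₀ : (transportAPackets ψ Pk' ξ v).πn ∈ (𝔩 v).mem ((𝔩 v).xiH ((rhoXiS hH ξ).fin.loc v)) :=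
    (mem_xiH_rhoXiS_iff hH ξ v _).2 (Or.inl rfl)
  refine hinj ξ v r ((𝔩 v).eq_of_meet (aTok v) (hKM1 v) (hKJ v) (transportAPackets ψ Pk' ξ v) (hKM3 ξ v)
    ((𝔩 v).mem_aTok_of_mem (aTok v) _ (hKM2 ξ v) hmem) ((𝔩 v).mem_aTok_of_mem (aTok v) _ (hKM2 ξ v) hmem₀) (Or.inl hmem) (Or.inl hmem₀))

/-! ## §3 (L3) from (KD3) + the A-fibre + Satake (good places) + strong multiplicity one on `H` (bad places) [Thm. 13.3.5 for `H`; (14.6.3)] -/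

/-- **(L3) `XiRigidityH` FROM (KD3), THE A-FIBRE, SATAKE AND ONE GLOBAL `H`-INPUT**: `hfibH` «an `H_v`-packet whose image contains `πⁿ(ξ_v)` is `ξ_v`» (kit fact; §2 derives it from the
marker laws + `ξ_H`-injectivity on the A-fibre); `hglobH` «a discrete `H`-packet with the ξ-germ that equals `ξ` off the finite set `S ∪ S₀ ∪ ram ξ` equals `ξ` at every place» (print: strong
multiplicity one for `H`; for character packets ★ `F0P3XiRigid`); the good places are supplied in-house by §2 (Satake injectivity).
[cite: Rogawski1990, §13.3 Thm. 13.3.5 p. 202, p. 203; §13.7 p. 206; §14.6 (14.6.3) p. 243] [cite: CartierCorvallis1979, §IV.1 Cor. 4.1] -/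
theorem xiRigidityH_of_fibre {hH : XiHPacketsSigned 𝔩 𝔞 𝔞H DiscH (transportAPackets ψ Pk') PkInf χ hχ ε κH}
    (hKD3 : ∀ (σ : GlobalPacketH 𝔩) (P P' : 𝔞H.PktInfH), DiscH σ P → DiscH σ P' → P = P')
    (hfibH : ∀ (ξ : OneDimAutRepH L) (v : HeightOneSpectrum (𝓞 ↥(maximalRealSubfield L))) (r : (𝔩 v).PktH),
      (transportAPackets ψ Pk' ξ v).πn ∈ (𝔩 v).mem ((𝔩 v).xiH r) → r = (rhoXiS hH ξ).fin.loc v)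
    (h4 : ∀ v : HeightOneSpectrum (𝓞 ↥(maximalRealSubfield L)), (𝔩 v).UnramLaw)
    (hKG3 : ∀ (v : HeightOneSpectrum (𝓞 ↥(maximalRealSubfield L))) (P : (𝔩 v).Pkt), ∀ π ∈ (𝔩 v).mem P, π.IsAdmissible)
    (S₀ : Finset (HeightOneSpectrum (𝓞 ↥(maximalRealSubfield L))))
    (hψK : ∀ v ∉ S₀, (cmLocalIntegralLevel L 3 H v).map (ψ v : (cmDatum L 3 H).Local v →* (cmDatum L 3 (splitForm L 3)).Local v) =
      cmLocalIntegralLevel L 3 (splitForm L 3) v)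
    (hvol : ∀ v : HeightOneSpectrum (𝓞 ↥(maximalRealSubfield L)), (νG' v).real (cmLocalIntegralLevel L 3 H v : Set ((cmDatum L 3 H).Local v)) ≠ 0)
    (hsph : ∀ (ξ : OneDimAutRepH L), ∀ v ∉ ram ξ, (Pk' ξ v).πn.IsSpherical (cmLocalIntegralLevel L 3 H v))
    (hadmn : ∀ (ξ : OneDimAutRepH L) (v : HeightOneSpectrum (𝓞 ↥(maximalRealSubfield L))), (Pk' ξ v).πn.IsAdmissible)
    {tXi : OneDimAutRepH L → EvpData L H}
    (ht : ∀ (ξ : OneDimAutRepH L), ∀ v ∉ ram ξ, tXi ξ v = (Pk' ξ v).πn.eigencharacter (cmLocalIntegralLevel L 3 H v) (νG' v))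
    (hglobH : ∀ (ξ : OneDimAutRepH L) (S : Finset (HeightOneSpectrum (𝓞 ↥(maximalRealSubfield L)))) (ρ : SpectralPacketH 𝔩 𝔞 𝔞H DiscH),
      EqOff L H S (ρ.evpHψ ψ (fun w => (νG' w).map (ψ w))) (tXi ξ) → ρ.ramFinsetH ⊆ S →
      (∀ v, v ∉ S → v ∉ S₀ → v ∉ ram ξ → ρ.fin.loc v = (rhoXiS hH ξ).fin.loc v) → ∀ v, ρ.fin.loc v = (rhoXiS hH ξ).fin.loc v) :
    XiRigidityH hH ψ (fun w => (νG' w).map (ψ w)) tXi := by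
  intro ξ S ρ hevp hram
  refine eq_of_loc_eq_of_discH_pins hKD3 (hglobH ξ S ρ hevp hram fun v hvS hv₀ hvr => ?_)
  exact hfibH ξ v _ (transport_πn_mem_xiH_of_eqOff h4 hKG3 S₀ hψK hvol hsph hadmn ht ξ hevp hram hvS hv₀ hvr)

/-- **(L3) `XiRigidityH` FROM THE MARKER LAWS (KM1)∕(KJ-G)∕(KM2)∕(KM3) + (KD3) + `ξ_H`-INJECTIVITY ON THE A-FIBRE + SATAKE + ONE GLOBAL `H`-INPUT** (§2 `fibreH_of_marker_laws` feeding
`xiRigidityH_of_fibre`). [cite: Rogawski1990, §13.3 Thm. 13.3.5 p. 202, Thm. 13.3.4 p. 202, p. 203; §13.1 p. 199 ¶2; §13.2 p. 200 l. 1–3; §13.7 p. 206] [cite: CartierCorvallis1979, §IV.1 Cor. 4.1] -/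
theorem xiRigidityH_of_marker_laws {hH : XiHPacketsSigned 𝔩 𝔞 𝔞H DiscH (transportAPackets ψ Pk') PkInf χ hχ ε κH}
    (hKM1 : ∀ (v : HeightOneSpectrum (𝓞 ↥(maximalRealSubfield L))) (P P' : (𝔩 v).Pkt), (𝔩 v).mem P = (𝔩 v).mem P' → (∀ c, (𝔩 v).one P c = (𝔩 v).one P' c) →
      (P ∈ aTok v ↔ P' ∈ aTok v) → P = P')
    (hKJ : ∀ (v : HeightOneSpectrum (𝓞 ↥(maximalRealSubfield L))) (P : (𝔩 v).Pkt) (c : IrrClass ((UnitaryGroup.cmDatum L 3 (splitForm L 3)).Local v)),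
      c ∉ (𝔩 v).mem P → (𝔩 v).one P c = 0)
    (hKM2 : ∀ (ξ : OneDimAutRepH L) (v : HeightOneSpectrum (𝓞 ↥(maximalRealSubfield L))) (P : (𝔩 v).Pkt), P ∉ aTok v →
      (transportAPackets ψ Pk' ξ v).πn ∉ (𝔩 v).mem P)
    (hKM3 : ∀ (ξ : OneDimAutRepH L) (v : HeightOneSpectrum (𝓞 ↥(maximalRealSubfield L))) (P : (𝔩 v).Pkt), P ∈ aTok v →
      ((transportAPackets ψ Pk' ξ v).πn ∈ (𝔩 v).mem P ∨ ∃ c, (transportAPackets ψ Pk' ξ v).πs = some c ∧ c ∈ (𝔩 v).mem P) →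
      (∀ c, c ∈ (𝔩 v).mem P ↔ (c = (transportAPackets ψ Pk' ξ v).πn ∨ (transportAPackets ψ Pk' ξ v).πs = some c)) ∧
        (𝔩 v).one P (transportAPackets ψ Pk' ξ v).πn = 1 ∧ ∀ c ∈ (𝔩 v).mem P, c ≠ (transportAPackets ψ Pk' ξ v).πn → (𝔩 v).one P c = -1)
    (hKD3 : ∀ (σ : GlobalPacketH 𝔩) (P P' : 𝔞H.PktInfH), DiscH σ P → DiscH σ P' → P = P')
    (hinj : ∀ (ξ : OneDimAutRepH L) (v : HeightOneSpectrum (𝓞 ↥(maximalRealSubfield L))) (r : (𝔩 v).PktH),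
      (𝔩 v).xiH r = (𝔩 v).xiH ((rhoXiS hH ξ).fin.loc v) → r = (rhoXiS hH ξ).fin.loc v)
    (h4 : ∀ v : HeightOneSpectrum (𝓞 ↥(maximalRealSubfield L)), (𝔩 v).UnramLaw)
    (hKG3 : ∀ (v : HeightOneSpectrum (𝓞 ↥(maximalRealSubfield L))) (P : (𝔩 v).Pkt), ∀ π ∈ (𝔩 v).mem P, π.IsAdmissible)
    (S₀ : Finset (HeightOneSpectrum (𝓞 ↥(maximalRealSubfield L))))
    (hψK : ∀ v ∉ S₀, (cmLocalIntegralLevel L 3 H v).map (ψ v : (cmDatum L 3 H).Local v →* (cmDatum L 3 (splitForm L 3)).Local v) =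
      cmLocalIntegralLevel L 3 (splitForm L 3) v)
    (hvol : ∀ v : HeightOneSpectrum (𝓞 ↥(maximalRealSubfield L)), (νG' v).real (cmLocalIntegralLevel L 3 H v : Set ((cmDatum L 3 H).Local v)) ≠ 0)
    (hsph : ∀ (ξ : OneDimAutRepH L), ∀ v ∉ ram ξ, (Pk' ξ v).πn.IsSpherical (cmLocalIntegralLevel L 3 H v))
    (hadmn : ∀ (ξ : OneDimAutRepH L) (v : HeightOneSpectrum (𝓞 ↥(maximalRealSubfield L))), (Pk' ξ v).πn.IsAdmissible)
    {tXi : OneDimAutRepH L → EvpData L H}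
    (ht : ∀ (ξ : OneDimAutRepH L), ∀ v ∉ ram ξ, tXi ξ v = (Pk' ξ v).πn.eigencharacter (cmLocalIntegralLevel L 3 H v) (νG' v))
    (hglobH : ∀ (ξ : OneDimAutRepH L) (S : Finset (HeightOneSpectrum (𝓞 ↥(maximalRealSubfield L)))) (ρ : SpectralPacketH 𝔩 𝔞 𝔞H DiscH),
      EqOff L H S (ρ.evpHψ ψ (fun w => (νG' w).map (ψ w))) (tXi ξ) → ρ.ramFinsetH ⊆ S →
      (∀ v, v ∉ S → v ∉ S₀ → v ∉ ram ξ → ρ.fin.loc v = (rhoXiS hH ξ).fin.loc v) → ∀ v, ρ.fin.loc v = (rhoXiS hH ξ).fin.loc v) :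
    XiRigidityH hH ψ (fun w => (νG' w).map (ψ w)) tXi :=
  xiRigidityH_of_fibre hKD3 (fibreH_of_marker_laws hH hKM1 hKJ hKM2 hKM3 hinj) h4 hKG3 S₀ hψK hvol hsph hadmn ht hglobH

end Good

end Summit.HodgeConjecture.HodgeConjecture.Cruxes.H413.F0P3SpectralPacket.SpectralPacketH

end
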